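import Mathlib
import HarnessLib

/-!
# Completeness from separation: a continuous function orthogonal to a separating family (or to all characters) is zero

Topic `RepresentationTheory/CompactGroups`; namespace `Literature.RepresentationTheory.CompactGroups`.

On a compact space `K` with a finite Borel measure `μ` positive on nonempty open sets (e.g. the Haar probability
measure of a compact group):

* `spanStarSubalgebra` — the ℂ-span of a family `S ⊆ C(K, ℂ)` that contains `1` and is closed under products
  and `star` is a star-subalgebra;
* `eq_zero_of_orthogonal_separating_family` — if such a family `S` separates the points of `K` and
  `x ∈ C(K, ℂ)` satisfies `∫ star(s)·x dμ = 0` for all `s ∈ S`, then `x = 0` (density of `span S` in sup norm by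
  Mathlib's Stone–Weierstrass theorem `ContinuousMap.starSubalgebra_topologicalClosure_eq_top_of_separatesPoints`,
  continuity of `p ↦ ∫ star(p)·x dμ`, then `∫ ‖x‖² dμ = 0`);
* `charCM χ ∈ C(K, ℂ)` — a continuous unitary character `χ : PontryaginDual K` as a continuous function, with
  `charCM_one`, `charCM_mul`, `star_charCM`;
* `eq_zero_of_forall_character_orthogonal` — **Fourier completeness on a compact group, from point separation**:
  if the continuous unitary characters of the compact group `K` separate points (for `K` abelian this is the
  Pontryagin–van Kampen theorem: A. Deitmar, S. Echterhoff, *Principles of Harmonic Analysis*, 2nd ed. (2014),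
  Prop. 3.5.2; E. Hewitt, K. A. Ross, *Abstract Harmonic Analysis* I, §22) and all Fourier coefficients
  `∫ conj(χ)·x dμ` of a continuous `x` vanish, then `x = 0` — the uniqueness half of the statement that the
  characters of a compact abelian group form an orthonormal basis of `L²` [folklore].

Everything here is proved from Mathlib; the separation property enters only as the hypothesis `hsep`.

## Provenance

Reproduced for the tree under the LEAN-IN-TREE rule (2026-08-18) from the pub-hodgecm cell's package file
`HodgeCM/PerL34/CharCompleteness.lean` (DAG-node prover #06 lineage, seat pv06 generation 0, gate run 21; 217 lines,
namespace `HodgeCM.PerL34.CharCompleteness`), verbatim up to the namespace and the docstrings; Mathlib only,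
nothing cited as a hypothesis, nothing posited.
-/

set_option autoImplicit false

open MeasureTheory Filter _root_.Topology

noncomputable section

namespace Literature.RepresentationTheory.CompactGroups

variable {K : Type*} [TopologicalSpace K] [CompactSpace K]

/-- The ℂ-span of a multiplicative, star-closed family containing `1` is a star-subalgebra of `C(K, ℂ)`. [folklore] -/
def spanStarSubalgebra (S : Set C(K, ℂ)) (h1 : (1 : C(K, ℂ)) ∈ S)
    (hmul : ∀ s ∈ S, ∀ t ∈ S, s * t ∈ S) (hstar : ∀ s ∈ S, star s ∈ S) :
    StarSubalgebra ℂ C(K, ℂ) where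
  carrier := Submodule.span ℂ S
  mul_mem' := fun {a b} ha hb => by
    have hab : a * b ∈ Submodule.span ℂ S * Submodule.span ℂ S := Submodule.mul_mem_mul ha hb
    rw [Submodule.span_mul_span] at hab
    refine Submodule.span_mono ?_ hab
    rintro u ⟨s, hs, t, ht, rfl⟩
    exact hmul s hs t ht
  one_mem' := Submodule.subset_span h1
  add_mem' := fun ha hb => Submodule.add_mem _ ha hb
  zero_mem' := Submodule.zero_mem _
  algebraMap_mem' := fun r => by
    rw [Algebra.algebraMap_eq_smul_one]
    exact Submodule.smul_mem _ r (Submodule.subset_span h1)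
  star_mem' := fun {a} ha => by
    show star a ∈ Submodule.span ℂ S
    induction ha using Submodule.span_induction with
    | mem s hs => exact Submodule.subset_span (hstar s hs)
    | zero => rw [star_zero]; exact Submodule.zero_mem _
    | add a b _ _ ha hb => rw [star_add]; exact Submodule.add_mem _ ha hb
    | smul c a _ ha => rw [star_smul]; exact Submodule.smul_mem _ _ ha

/-- Membership in `spanStarSubalgebra S` is membership in the ℂ-span of `S`. [folklore] -/
theorem mem_spanStarSubalgebra {S : Set C(K, ℂ)} {h1 hmul hstar} {p : C(K, ℂ)} :
    p ∈ spanStarSubalgebra S h1 hmul hstar ↔ p ∈ Submodule.span ℂ S := Iff.rfl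

section Family

variable [MeasurableSpace K] [OpensMeasurableSpace K] (μ : Measure K) [IsFiniteMeasure μ]
  [μ.IsOpenPosMeasure]

/-- **Completeness from separation.**  On a compact space with a finite measure positive on opens, a
continuous function orthogonal to a point-separating, multiplicative, star-closed family containing `1`
vanishes identically (Stone–Weierstrass density of the family's span in sup norm, continuity of
`p ↦ ∫ star p · x dμ`, and `∫ ‖x‖² dμ = 0 ⇒ x = 0` for a measure positive on opens). [folklore] -/
theorem eq_zero_of_orthogonal_separating_family (S : Set C(K, ℂ)) (h1 : (1 : C(K, ℂ)) ∈ S)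
    (hmul : ∀ s ∈ S, ∀ t ∈ S, s * t ∈ S) (hstar : ∀ s ∈ S, star s ∈ S)
    (hsep : ∀ k₁ k₂ : K, k₁ ≠ k₂ → ∃ s ∈ S, s k₁ ≠ s k₂)
    (x : C(K, ℂ)) (horth : ∀ s ∈ S, ∫ k, star (s k) * x k ∂μ = 0) : x = 0 := by
  -- the (conjugate-linear) functional `Φ p = ∫ star(p)·x dμ`
  set Φ : C(K, ℂ) → ℂ := fun p => ∫ k, star (p k) * x k ∂μ with hΦ
  have hint : ∀ p : C(K, ℂ), Integrable (fun k => star (p k) * x k) μ := fun p =>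
    ((continuous_star.comp p.continuous).mul x.continuous).integrable_of_hasCompactSupport
      (HasCompactSupport.of_compactSpace _)
  have hΦadd : ∀ p q, Φ (p + q) = Φ p + Φ q := by
    intro p q
    simp only [hΦ, ContinuousMap.add_apply, star_add, add_mul]
    exact integral_add (hint p) (hint q)
  have hΦsmul : ∀ (c : ℂ) (p : C(K, ℂ)), Φ (c • p) = star c * Φ p := by
    intro c p
    simp only [hΦ, ContinuousMap.smul_apply, smul_eq_mul, star_mul', mul_assoc]
    exact integral_const_mul _ _
  -- `Φ` vanishes on `span S`
  have hΦspan : ∀ p ∈ Submodule.span ℂ S, Φ p = 0 := by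
    intro p hp
    induction hp using Submodule.span_induction with
    | mem s hs => exact horth s hs
    | zero => simp [hΦ]
    | add a b _ _ ha hb => rw [hΦadd, ha, hb, add_zero]
    | smul c a _ ha => rw [hΦsmul, ha, mul_zero]
  -- `Φ` is Lipschitz for the sup norm
  have hΦbd : ∀ p q, ‖Φ p - Φ q‖ ≤ ‖p - q‖ * ‖x‖ * μ.real Set.univ := by
    intro p q
    have hpq : Φ p - Φ q = ∫ k, star ((p - q) k) * x k ∂μ := by
      rw [hΦ]
      simp only
      rw [← integral_sub (hint p) (hint q)]
      congr 1
      funext k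
      simp [sub_mul]
    rw [hpq]
    refine norm_integral_le_of_norm_le_const (ae_of_all _ fun k => ?_)
    rw [norm_mul, norm_star]
    exact mul_le_mul ((p - q).norm_coe_le_norm k) (x.norm_coe_le_norm k) (norm_nonneg _)
      (norm_nonneg _)
  -- Stone–Weierstrass: `x ∈ closure (span S)`
  let A := spanStarSubalgebra S h1 hmul hstar
  have hA : A.SeparatesPoints := by
    intro k₁ k₂ hk
    obtain ⟨s, hs, hsk⟩ := hsep k₁ k₂ hk
    exact ⟨s, ⟨s, Submodule.subset_span hs, rfl⟩, hsk⟩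
  have hdense : x ∈ closure (Submodule.span ℂ S : Set C(K, ℂ)) := by
    have htop := ContinuousMap.starSubalgebra_topologicalClosure_eq_top_of_separatesPoints A hA
    have hx : x ∈ A.topologicalClosure := by rw [htop]; exact StarSubalgebra.mem_top
    exact hx
  obtain ⟨p, hpS, hpx⟩ := mem_closure_iff_seq_limit.mp hdense
  -- hence `Φ x = 0`
  have hΦx : Φ x = 0 := by
    have h0 : Tendsto (fun n => ‖p n - x‖ * ‖x‖ * μ.real Set.univ) atTop (𝓝 0) := by
      simpa using ((tendsto_iff_norm_sub_tendsto_zero.mp hpx).mul_const ‖x‖).mul_const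
        (μ.real Set.univ)
    have hle : ‖Φ x‖ ≤ 0 := ge_of_tendsto' h0 fun n => by
      have := hΦbd (p n) x
      rwa [hΦspan _ (hpS n), zero_sub, norm_neg] at this
    exact norm_le_zero_iff.mp hle
  -- `Φ x = ∫ ‖x‖²`, so `x = 0`
  have hsq : ∫ k, ‖x k‖ ^ 2 ∂μ = 0 := by
    have hx2 : Φ x = ((∫ k, ‖x k‖ ^ 2 ∂μ : ℝ) : ℂ) := by
      rw [hΦ]
      simp only
      rw [← integral_complex_ofReal]
      congr 1
      funext k
      rw [Complex.star_def, Complex.conj_mul']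
      push_cast
      ring
    exact_mod_cast hx2.symm.trans hΦx
  have hcont : Continuous fun k => ‖x k‖ ^ 2 := by fun_prop
  ext k
  rw [ContinuousMap.zero_apply]
  by_contra hk
  have hpos := hcont.integral_pos_of_hasCompactSupport_nonneg_nonzero (μ := μ)
    (HasCompactSupport.of_compactSpace _) (fun k => sq_nonneg _)
    (pow_ne_zero 2 (norm_ne_zero_iff.mpr hk))
  exact hpos.ne' hsq

end Family

/-! ## Characters -/
section Characters

variable [Group K]

omit [CompactSpace K] in
/-- A continuous unitary character as an element of `C(K, ℂ)`. [folklore] -/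
def charCM (χ : PontryaginDual K) : C(K, ℂ) :=
  ⟨fun k => ((χ k : Circle) : ℂ), continuous_subtype_val.comp (map_continuous χ)⟩

omit [CompactSpace K] in
/-- Pointwise value of `charCM χ`. [folklore] -/
@[simp] theorem charCM_apply (χ : PontryaginDual K) (k : K) : charCM χ k = ((χ k : Circle) : ℂ) :=
  rfl

omit [CompactSpace K] in
/-- The trivial character is the constant function `1`. [folklore] -/
theorem charCM_one : charCM (1 : PontryaginDual K) = 1 := by
  ext k; rfl

omit [CompactSpace K] in
/-- `charCM` is multiplicative. [folklore] -/
theorem charCM_mul (χ ψ : PontryaginDual K) : charCM χ * charCM ψ = charCM (χ * ψ) := by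
  ext k
  show ((χ k : Circle) : ℂ) * ((ψ k : Circle) : ℂ) = (((χ * ψ) k : Circle) : ℂ)
  rw [← Circle.coe_mul]
  rfl

omit [CompactSpace K] in
/-- The conjugate of a unitary character is its inverse. [folklore] -/
theorem star_charCM (χ : PontryaginDual K) : star (charCM χ) = charCM χ⁻¹ := by
  ext k
  rw [ContinuousMap.star_apply, charCM_apply, charCM_apply, Complex.star_def,
    ← Circle.coe_inv_eq_conj]
  rfl

/-- **Fourier completeness on a compact group, from point separation.**  `K` a compact topological
group with a finite measure positive on opens (e.g. its Haar probability measure); if the continuous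
unitary characters separate the points of `K` (hypothesis `hsep`; for `K` abelian this is the
Pontryagin–van Kampen theorem, Deitmar–Echterhoff, *Principles of Harmonic Analysis*, Prop. 3.5.2) and all
Fourier coefficients `∫ conj(χ)·x dμ` of `x ∈ C(K, ℂ)` vanish, then `x = 0`. [folklore] -/
theorem eq_zero_of_forall_character_orthogonal [MeasurableSpace K] [OpensMeasurableSpace K]
    (μ : Measure K) [IsFiniteMeasure μ] [μ.IsOpenPosMeasure]
    (hsep : ∀ k₁ k₂ : K, k₁ ≠ k₂ → ∃ χ : PontryaginDual K, χ k₁ ≠ χ k₂)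
    (x : C(K, ℂ)) (horth : ∀ χ : PontryaginDual K, ∫ k, star ((χ k : Circle) : ℂ) * x k ∂μ = 0) :
    x = 0 := by
  refine eq_zero_of_orthogonal_separating_family μ (Set.range (charCM (K := K)))
    ⟨1, charCM_one⟩ ?_ ?_ ?_ x ?_
  · rintro _ ⟨χ, rfl⟩ _ ⟨ψ, rfl⟩
    exact ⟨χ * ψ, (charCM_mul χ ψ).symm⟩
  · rintro _ ⟨χ, rfl⟩
    exact ⟨χ⁻¹, (star_charCM χ).symm⟩
  · intro k₁ k₂ hk
    obtain ⟨χ, hχ⟩ := hsep k₁ k₂ hk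
    exact ⟨charCM χ, ⟨χ, rfl⟩, fun h => hχ (Circle.ext h)⟩
  · rintro _ ⟨χ, rfl⟩
    exact horth χ

end Characters

end Literature.RepresentationTheory.CompactGroups

end
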